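import Literature.NumberTheory.LFunctions.ConnesProlateGuessSupNorm

/-!
# Connes' Fact 6.4 as a consequence of the named fact "CCM25 Lemma 7.2(i)"

`ConnesProlateGuessSupNorm.lean` proves `prolateGuess_tendsto_riemannXi` (Connes 2026, Fact 6.4 =
Connes–Consani–Moscovici 2025, Lemma 7.3) from the sup-norm asymptotics of the normalised prolate
spheroidal functions, `max_{[−λ,λ]}|h_{n,λ} − h_n| ≤ C_n λ^{-2}` for `n = 0, 4`, taken as explicit
hypotheses.  This file records that published input — CCM25 Lemma 7.2(i), eq. (7.7), which the
authors take from Meixner–Schäfke 1954, §3.2 Satz 9 — as a cite-tagged NAMED FACT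
`prolateSupNormRate n g` (instantiated at `(0, hermiteH0)` and `(4, hermiteH4)`; the tree's
`IsProlateFunction lam n` = the `L²`-normalised eigenfunction of `W_λ` with `n` zeros, positive at
`0`; `hermiteH0`, `hermiteH4` = the `L²`-normalised Hermite functions, positive at `0`), and the
one-line corollary `prolateGuess_tendsto_riemannXi_of_supNormRate`.  It is not proved in THIS file;
both instances used by the corollary are now tree THEOREMS — `prolateSupNormRate_zero :
prolateSupNormRate 0 hermiteH0` and `prolateSupNormRate_four : prolateSupNormRate 4 hermiteH4`
(`ProlateSupNormRate.lean`, proved from the interface `IsProlateFunction` alone), so the corollary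
is hypothesis-free there.  THIS IS NOT AN RH STATEMENT.
-/

noncomputable section

open Real Set

namespace Literature.NumberTheory.LFunctions

/-- **CCM25 Lemma 7.2(i), eq. (7.7)** (sup-norm prolate → Hermite asymptotics with rate, after
Meixner–Schäfke 1954 §3.2 Satz 9), as a named fact: there are `C, Λ` such that for `λ ≥ Λ` every
`L²`-normalised prolate function with `n` zeros (`IsProlateFunction lam n f`) satisfies
`|f(x) − g(x)| ≤ C/λ²` on `[−λ, λ]`; used with `g = hermiteH0` (`n = 0`) and `g = hermiteH4`
(`n = 4`).  A definition (named statement), used as a hypothesis by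
`prolateGuess_tendsto_riemannXi_of_supNormRate`; the instances `(0, hermiteH0)` and `(4, hermiteH4)`
are PROVED in `ProlateSupNormRate.lean` (`prolateSupNormRate_zero`, `prolateSupNormRate_four`).
[cite: ConnesConsaniMoscovici2025, Lemma 7.2] -/
def prolateSupNormRate (n : ℕ) (g : ℝ → ℝ) : Prop :=
  ∃ C Λ : ℝ, ∀ lam : ℝ, Λ ≤ lam → ∀ f : ℝ → ℝ, IsProlateFunction lam n f →
    ∀ x ∈ Icc (-lam) lam, |f x - g x| ≤ C / lam ^ 2

/-- **Fact 6.4 ⇐ CCM25 Lemma 7.2(i).**  Connes' prolate guess converges to `Ξ` uniformly on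
`|Re s| ≤ α₀ < 1/2` (`prolateGuess_tendsto_riemannXi`), granted the published sup-norm asymptotics
for `n = 0` and `n = 4`. [cite: ConnesConsaniMoscovici2025, Lemma 7.2, Lemma 7.3] -/
theorem prolateGuess_tendsto_riemannXi_of_supNormRate (h0 : prolateSupNormRate 0 hermiteH0)
    (h4 : prolateSupNormRate 4 hermiteH4) : prolateGuess_tendsto_riemannXi := by
  obtain ⟨C₀, Λ₀, hS0⟩ := h0
  obtain ⟨C₄, Λ₄, hS4⟩ := h4
  exact prolateGuess_tendsto_riemannXi_of_supNorm hS0 hS4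

end Literature.NumberTheory.LFunctions
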